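import Summits.KontsevichZagierPeriods.KontsevichZagierPeriods.Theorems.LinRedNormalFormArrangementNormalFormSeparateTwoComparison

/-!
# Confined fibres stay in the core

(Line `janus-bands`, crux `ArrangementNormalForm`, stub `stub_separateTwo`, part `Confine`.)
The easy half of the confinement combinatorics of the `stub_separateTwo` roadmap (case of a
touching vertex on a degenerating polar edge): a fibre is CONFINED to a set of atoms `Q` if its
lower bound is an atom of `Q` or a confined fibre, and likewise its upper bound — the least fixed
point `confined lo hi Q = ⋃ₙ confStep^[n] ∅` of the monotone operator `confStep`. At every point
of the cell, a confined fibre lies strictly between any lower bound and any upper bound of the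
values of `Q` (`confined_bounds`, registered as `separateTwo_confine`) — the hypothesis under
which `SepTwo.lmass_comp_le_gain` (part `ComparisonGain`) may assign to that fibre the
contraction factor of the core as its constant. The converse half (placing all non-confined
fibres outside the windows at some cell point) is the open PLACEMENT lemma of the roadmap.
-/

noncomputable section

open Set

namespace Summit.KontsevichZagierPeriods.ArrangementNormalForm.JanusBands

namespace SepTwo

variable {k : ℕ} {ι : Type*}

/-- One confinement step: fibres whose two bounds are atoms of `Q` or fibres of `S`. -/
def confStep (lo hi : Fin k → Fin k ⊕ ι) (Q : Set ι) (S : Set (Fin k)) : Set (Fin k) :=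
  {i | ((∃ c ∈ Q, lo i = Sum.inr c) ∨ ∃ j ∈ S, lo i = Sum.inl j) ∧
    ((∃ c ∈ Q, hi i = Sum.inr c) ∨ ∃ j ∈ S, hi i = Sum.inl j)}

/-- The fibres confined to `Q` by their bound chains (least fixed point of `confStep`). -/
def confined (lo hi : Fin k → Fin k ⊕ ι) (Q : Set ι) : Set (Fin k) :=
  ⋃ n : ℕ, (confStep lo hi Q)^[n] ∅

/-- One step preserves the core bounds. -/
theorem confStep_bounds {lo hi : Fin k → Fin k ⊕ ι} {Q : Set ι} {α : ι → ℝ} {m₁ m₂ : ℝ}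
    (hm₁ : ∀ c ∈ Q, m₁ ≤ α c) (hm₂ : ∀ c ∈ Q, α c ≤ m₂) {t : Fin k → ℝ}
    (ht : t ∈ cell lo hi α) {S : Set (Fin k)} (hS : ∀ j ∈ S, m₁ < t j ∧ t j < m₂) :
    ∀ i ∈ confStep lo hi Q S, m₁ < t i ∧ t i < m₂ := by
  intro i hi
  obtain ⟨hlo, hhi⟩ := hi
  obtain ⟨h1, h2⟩ := ht i
  constructor
  · rcases hlo with ⟨c, hcQ, hc⟩ | ⟨j, hj, hjc⟩
    · rw [hc] at h1
      exact (hm₁ c hcQ).trans_lt h1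
    · rw [hjc] at h1
      exact (hS j hj).1.trans h1
  · rcases hhi with ⟨c, hcQ, hc⟩ | ⟨j, hj, hjc⟩
    · rw [hc] at h2
      exact h2.trans_le (hm₂ c hcQ)
    · rw [hjc] at h2
      exact h2.trans (hS j hj).2

/-- Every stage preserves the core bounds. -/
theorem iterate_confStep_bounds {lo hi : Fin k → Fin k ⊕ ι} {Q : Set ι} {α : ι → ℝ} {m₁ m₂ : ℝ}
    (hm₁ : ∀ c ∈ Q, m₁ ≤ α c) (hm₂ : ∀ c ∈ Q, α c ≤ m₂) {t : Fin k → ℝ}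
    (ht : t ∈ cell lo hi α) (n : ℕ) :
    ∀ i ∈ (confStep lo hi Q)^[n] ∅, m₁ < t i ∧ t i < m₂ := by
  induction n with
  | zero => intro i hi; exact absurd hi (notMem_empty i)
  | succ n ih =>
    rw [Function.iterate_succ_apply']
    exact confStep_bounds hm₁ hm₂ ht ih

/-- **Confined fibres stay in the core.** -/
theorem confined_bounds {lo hi : Fin k → Fin k ⊕ ι} {Q : Set ι} {α : ι → ℝ} {m₁ m₂ : ℝ}
    (hm₁ : ∀ c ∈ Q, m₁ ≤ α c) (hm₂ : ∀ c ∈ Q, α c ≤ m₂) {t : Fin k → ℝ}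
    (ht : t ∈ cell lo hi α) {i : Fin k} (hi : i ∈ confined lo hi Q) : m₁ < t i ∧ t i < m₂ := by
  obtain ⟨n, hn⟩ := mem_iUnion.1 hi
  exact iterate_confStep_bounds hm₁ hm₂ ht n i hn

/-- `confStep` is monotone. -/
theorem confStep_mono (lo hi : Fin k → Fin k ⊕ ι) (Q : Set ι) : Monotone (confStep lo hi Q) := by
  intro S T hST i hi
  obtain ⟨hlo, hhi⟩ := hi
  refine ⟨hlo.imp id fun ⟨j, hj, hjc⟩ => ⟨j, hST hj, hjc⟩, hhi.imp id fun ⟨j, hj, hjc⟩ => ⟨j, hST hj, hjc⟩⟩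

/-- The stages increase. -/
theorem iterate_confStep_mono (lo hi : Fin k → Fin k ⊕ ι) (Q : Set ι) (n : ℕ) :
    (confStep lo hi Q)^[n] ∅ ⊆ (confStep lo hi Q)^[n + 1] ∅ := by
  induction n with
  | zero => exact empty_subset _
  | succ n ih =>
    rw [Function.iterate_succ_apply', Function.iterate_succ_apply']
    exact confStep_mono lo hi Q ih

/-- `confined` is closed under `confStep` (so it is a fixed point): a fibre whose bounds are atoms
of `Q` or confined fibres is confined. -/
theorem confStep_confined_subset (lo hi : Fin k → Fin k ⊕ ι) (Q : Set ι) :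
    confStep lo hi Q (confined lo hi Q) ⊆ confined lo hi Q := by
  intro i hi
  obtain ⟨hlo, hhi⟩ := hi
  -- both fibre bounds (if any) appear at finite stages; take the later one
  have hstage : ∀ j ∈ confined lo hi Q, ∃ n, j ∈ (confStep lo hi Q)^[n] ∅ := fun j hj => mem_iUnion.1 hj
  have hmono : ∀ {n m : ℕ}, n ≤ m → (confStep lo hi Q)^[n] ∅ ⊆ (confStep lo hi Q)^[m] ∅ := by
    intro n m hnm
    induction hnm with
    | refl => exact Subset.rfl
    | step _ ih => exact ih.trans (iterate_confStep_mono lo hi Q _)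
  obtain ⟨n₁, hn₁⟩ : ∃ n, (∃ c ∈ Q, lo i = Sum.inr c) ∨ ∃ j ∈ (confStep lo hi Q)^[n] ∅, lo i = Sum.inl j := by
    rcases hlo with h | ⟨j, hj, hjc⟩
    · exact ⟨0, Or.inl h⟩
    · obtain ⟨n, hn⟩ := hstage j hj
      exact ⟨n, Or.inr ⟨j, hn, hjc⟩⟩
  obtain ⟨n₂, hn₂⟩ : ∃ n, (∃ c ∈ Q, hi i = Sum.inr c) ∨ ∃ j ∈ (confStep lo hi Q)^[n] ∅, hi i = Sum.inl j := by
    rcases hhi with h | ⟨j, hj, hjc⟩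
    · exact ⟨0, Or.inl h⟩
    · obtain ⟨n, hn⟩ := hstage j hj
      exact ⟨n, Or.inr ⟨j, hn, hjc⟩⟩
  refine mem_iUnion.2 ⟨max n₁ n₂ + 1, ?_⟩
  rw [Function.iterate_succ_apply']
  refine ⟨hn₁.imp id fun ⟨j, hj, hjc⟩ => ⟨j, hmono (le_max_left _ _) hj, hjc⟩,
    hn₂.imp id fun ⟨j, hj, hjc⟩ => ⟨j, hmono (le_max_right _ _) hj, hjc⟩⟩

end SepTwo

/-- **Confined fibres stay in the core** (registered sub-goal of `stub_separateTwo`; literal form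
of `SepTwo.confined_bounds`). -/
theorem separateTwo_confine (k : ℕ) (ι : Type) (lo hi : Fin k → Fin k ⊕ ι) (Q : Set ι) (α : ι → ℝ) (m₁ m₂ : ℝ) (hm₁ : ∀ c ∈ Q, m₁ ≤ α c) (hm₂ : ∀ c ∈ Q, α c ≤ m₂) (t : Fin k → ℝ) (ht : t ∈ {t : Fin k → ℝ | ∀ i, Sum.elim t α (lo i) < t i ∧ t i < Sum.elim t α (hi i)}) (i : Fin k) (hi : i ∈ SepTwo.confined lo hi Q) : m₁ < t i ∧ t i < m₂ := by
  exact SepTwo.confined_bounds hm₁ hm₂ ht hi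

end Summit.KontsevichZagierPeriods.ArrangementNormalForm.JanusBands
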